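import Summits.AtomisticToContinuum.BoseEinsteinCondensation.Theses.BECConjugateDomination
import Literature.MathematicalPhysics.QuantumManyBody.PeriodicClusteringFromKyFanGap
import Literature.MathematicalPhysics.QuantumManyBody.PeriodicKineticBudget
import HarnessLib

/-!
# Gradient convergence of truncation minimisers from `L²` convergence (line `third-law-current-floor`,
# crux `HardCoreExtension`, stmt-AtomisticToContinuum-11786; node P2 of the (α') plan)

At fixed `(N, L)` let `vₘ = min(v, m) ≤ vₙ = min(v, n)` (`m ≤ n`) be two truncations of a measurable pair potential
and `Ψₘ`, `Ψₙ` exact minimisers of the corresponding periodic energies (finite). Then the KINETIC energy of the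
difference is controlled by the energy increment and the `L²(cell)` distance:

  `∫_cell |∇(Ψₙ − Ψₘ)|² ≤ 2 (E₀(vₙ) − E₀(vₘ)) + E₀(vₘ) · ∫_cell |Ψₙ − Ψₘ|²`

(`stub_truncationMinimisersGradientCauchy`). Proof: the parallelogram law for the `vₘ`-energy form `qₘ`
(`lintegral_periodicEnergy_add_add_sub`) on the pair `Ψₙ ± Ψₘ`, monotonicity `qₘ(Ψₙ) ≤ qₙ(Ψₙ) = E₀(vₙ)`, the variational
principle `qₘ(Ψₙ + Ψₘ) ≥ E₀(vₘ)‖Ψₙ + Ψₘ‖²` for the `C¹` Bose state `Ψₙ + Ψₘ`, and `‖Ψₙ + Ψₘ‖² + ‖Ψₙ − Ψₘ‖² = 4`.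
Consequence (used by the `C¹` cut-off scheme for (α')): along an `L²`-Cauchy subsequence of positive truncation
minimisers (Rellich), the gradients are Cauchy in `L²(cell)` as well — `E₀(vₙ)` being monotone and bounded by
`E₀(v) < ⊤` — so their kinetic energy cannot concentrate on the (Lebesgue-null) hard wall. No weak topology, no limit
object, no form-core statement is needed. [folklore; the convexity argument of LiebLoss2001 Thm 11.8 / Simon1978]
-/

noncomputable section

namespace Summit.AtomisticToContinuum.BoseEinsteinCondensation.Cruxes.HardCoreExtension.ThirdLawCurrentFloor

open MeasureTheory Filter
open scoped ENNReal NNReal BigOperators Topology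
open Literature.MathematicalPhysics.QuantumManyBody.BoseGas

namespace GradientCauchy

variable {N : ℕ} {L : ℝ}

/-- **The variational principle for an unnormalised `C¹` Bose function**: `E₀(w) · ‖u‖²_cell ≤ q_w(u)` for every
periodic, Bose-symmetric `C¹` function `u` (normalise `u`, or both sides vanish / the mass is `≤ 4 < ⊤` here by
hypothesis). [folklore] -/
theorem groundStateEnergy_mul_mass_le_form (w : ℝ → ℝ≥0∞) {u : Config N → ℂ} (hu : ContDiff ℝ 1 u)
    (hper : ∀ (X : Config N) (i : Fin N) (k : Fin 3),
      u (X + Pi.single i (EuclideanSpace.single k L)) = u X)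
    (hsymm : ∀ (σ : Equiv.Perm (Fin N)) (X : Config N), u (X ∘ σ) = u X)
    (htop : ∫⁻ X in cellN N L, ((‖u X‖₊ : ℝ≥0∞)) ^ 2 ≠ ⊤) :
    periodicGroundStateEnergy w N L * ∫⁻ X in cellN N L, ((‖u X‖₊ : ℝ≥0∞)) ^ 2 ≤
      ∫⁻ X in cellN N L, kineticDensity u X + periodicInteraction w L X * ((‖u X‖₊ : ℝ≥0∞)) ^ 2 := by
  by_cases h0 : ∫⁻ X in cellN N L, ((‖u X‖₊ : ℝ≥0∞)) ^ 2 = 0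
  · rw [h0, mul_zero]; exact bot_le
  obtain ⟨Ψ, a, hΨ, ha⟩ := exists_periodicTrialState_const_mul hu hper hsymm h0 htop
  have hE : periodicEnergy w Ψ = ((‖(a : ℂ)‖₊ : ℝ≥0∞)) ^ 2 *
      ∫⁻ X in cellN N L, kineticDensity u X + periodicInteraction w L X * ((‖u X‖₊ : ℝ≥0∞)) ^ 2 := by
    unfold periodicEnergy; rw [hΨ]; exact lintegral_periodicEnergy_const_mul w L (a : ℂ) hu
  rw [ha] at hE
  calc periodicGroundStateEnergy w N L * ∫⁻ X in cellN N L, ((‖u X‖₊ : ℝ≥0∞)) ^ 2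
      ≤ periodicEnergy w Ψ * ∫⁻ X in cellN N L, ((‖u X‖₊ : ℝ≥0∞)) ^ 2 :=
        mul_le_mul' (periodicGroundStateEnergy_le w Ψ) le_rfl
    _ = _ := by rw [hE, mul_comm _⁻¹, mul_assoc, ENNReal.inv_mul_cancel h0 htop, mul_one]

end GradientCauchy

open GradientCauchy

/-- **`stub_truncationMinimisersGradientCauchy`** (node P2 of the (α') plan of line `third-law-current-floor`). For a
measurable pair potential `v`, heights `m ≤ n`, and exact minimisers `Ψₘ`, `Ψₙ` of the truncated periodic energies at
`(N, L)` with `E₀(vₙ) < ⊤`: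
`∫_cell |∇(Ψₙ − Ψₘ)|² ≤ 2(E₀(vₙ) − E₀(vₘ)) + E₀(vₘ)·∫_cell|Ψₙ − Ψₘ|²` (parallelogram law for the `vₘ`-form, monotonicity
in the potential, the variational principle for `Ψₙ + Ψₘ`). [folklore] -/
theorem stub_truncationMinimisersGradientCauchy :
    ∀ (v : ℝ → ℝ≥0∞), Measurable v → ∀ (N : ℕ) (L : ℝ) (m n : ℕ), m ≤ n →
      ∀ Ψm Ψn : PeriodicTrialState N L,
        periodicEnergy (fun r => min (v r) (m : ℝ≥0∞)) Ψm =
          periodicGroundStateEnergy (fun r => min (v r) (m : ℝ≥0∞)) N L →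
        periodicEnergy (fun r => min (v r) (n : ℝ≥0∞)) Ψn =
          periodicGroundStateEnergy (fun r => min (v r) (n : ℝ≥0∞)) N L →
        periodicEnergy (fun r => min (v r) (n : ℝ≥0∞)) Ψn ≠ ⊤ →
        ∫⁻ X in cellN N L, kineticDensity (fun Y => Ψn.ψ Y - Ψm.ψ Y) X ≤
          2 * (periodicGroundStateEnergy (fun r => min (v r) (n : ℝ≥0∞)) N L -
              periodicGroundStateEnergy (fun r => min (v r) (m : ℝ≥0∞)) N L) +
            periodicGroundStateEnergy (fun r => min (v r) (m : ℝ≥0∞)) N L *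
              ∫⁻ X in cellN N L, ((‖Ψn.ψ X - Ψm.ψ X‖₊ : ℝ≥0∞)) ^ 2 := by
  intro v hv N L m n hmn Ψm Ψn hΨm hΨn hfin
  -- notation: the two truncations
  set wm : ℝ → ℝ≥0∞ := fun r => min (v r) (m : ℝ≥0∞) with hwm
  set wn : ℝ → ℝ≥0∞ := fun r => min (v r) (n : ℝ≥0∞) with hwn
  have hwm_meas : Measurable wm := hv.min measurable_const
  have hle : ∀ r, wm r ≤ wn r := fun r => by
    simp only [hwm, hwn]
    exact min_le_min le_rfl (by exact_mod_cast hmn)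
  -- (2)-(3) the two energies: `q_m(Ψₘ) = E_m`, `q_m(Ψₙ) ≤ q_n(Ψₙ) = E_n`, finiteness
  have hqn : periodicEnergy wm Ψn ≤ periodicGroundStateEnergy wn N L :=
    (periodicEnergy_mono_of_le hle Ψn).trans hΨn.le
  have hEmn : periodicGroundStateEnergy wm N L ≤ periodicGroundStateEnergy wn N L :=
    periodicGroundStateEnergy_mono_of_le hle
  have hEn_top : periodicGroundStateEnergy wn N L ≠ ⊤ := fun h => hfin (hΨn.trans h)
  have hEm_top : periodicGroundStateEnergy wm N L ≠ ⊤ := ne_top_of_le_ne_top hEn_top hEmn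
  -- (1) parallelogram law for the form and for the mass
  have hpar := lintegral_periodicEnergy_add_add_sub hwm_meas L Ψn.contDiff Ψm.contDiff
  have hmass : (∫⁻ X in cellN N L, ((‖Ψn.ψ X + Ψm.ψ X‖₊ : ℝ≥0∞)) ^ 2) +
      (∫⁻ X in cellN N L, ((‖Ψn.ψ X - Ψm.ψ X‖₊ : ℝ≥0∞)) ^ 2) = 4 := by
    rw [lintegral_cellN_sq_add_add_sub L Ψn.contDiff.continuous Ψm.contDiff.continuous,
      Ψn.norm_eq, Ψm.norm_eq]
    norm_num
  -- (4) variational principle for `Ψₙ + Ψₘ`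
  have hsp_top : (∫⁻ X in cellN N L, ((‖Ψn.ψ X + Ψm.ψ X‖₊ : ℝ≥0∞)) ^ 2) ≠ ⊤ :=
    ne_top_of_le_ne_top (by norm_num) (hmass ▸ le_self_add)
  have hvar := groundStateEnergy_mul_mass_le_form (L := L) wm (Ψn.contDiff.add Ψm.contDiff)
      (fun X i k => by rw [Ψn.periodic, Ψm.periodic]) (fun σ X => by rw [Ψn.symm, Ψm.symm]) hsp_top
  -- abbreviate the scalars AFTER all lemma applications
  generalize hEm : periodicGroundStateEnergy wm N L = Em at *
  generalize hEn : periodicGroundStateEnergy wn N L = En at *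
  generalize hqp : (∫⁻ X in cellN N L, kineticDensity (fun Y => Ψn.ψ Y + Ψm.ψ Y) X +
      periodicInteraction wm L X * ((‖Ψn.ψ X + Ψm.ψ X‖₊ : ℝ≥0∞)) ^ 2) = qp at *
  generalize hqm' : (∫⁻ X in cellN N L, kineticDensity (fun Y => Ψn.ψ Y - Ψm.ψ Y) X +
      periodicInteraction wm L X * ((‖Ψn.ψ X - Ψm.ψ X‖₊ : ℝ≥0∞)) ^ 2) = qm' at *
  generalize hsp : (∫⁻ X in cellN N L, ((‖Ψn.ψ X + Ψm.ψ X‖₊ : ℝ≥0∞)) ^ 2) = sp at *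
  generalize hsm : (∫⁻ X in cellN N L, ((‖Ψn.ψ X - Ψm.ψ X‖₊ : ℝ≥0∞)) ^ 2) = sm at *
  -- `periodicEnergy wm Ψm = Em`, `periodicEnergy wm Ψn ≤ En`
  -- (6) combine: `q_m(Ψₙ - Ψₘ) + 4 E_m ≤ 2 (E_n - E_m) + E_m s_m + 4 E_m`
  have h1 : qm' + Em * 4 ≤ 2 * En + 2 * Em + Em * sm := by
    calc qm' + Em * 4 = qm' + (Em * sp + Em * sm) := by rw [← mul_add, hmass]
      _ ≤ qm' + (qp + Em * sm) := by gcongr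
      _ = (qp + qm') + Em * sm := by ring
      _ = 2 * periodicEnergy wm Ψn + 2 * periodicEnergy wm Ψm + Em * sm := by rw [hpar]; rfl
      _ ≤ 2 * En + 2 * Em + Em * sm := by rw [hΨm]; gcongr
  have h2 : 2 * En + 2 * Em + Em * sm = 2 * (En - Em) + Em * sm + 4 * Em := by
    conv_lhs => rw [← tsub_add_cancel_of_le hEmn]
    ring
  have hkey : qm' + 4 * Em ≤ 2 * (En - Em) + Em * sm + 4 * Em := by
    calc qm' + 4 * Em = qm' + Em * 4 := by ring
      _ ≤ 2 * En + 2 * Em + Em * sm := h1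
      _ = _ := h2
  have h4top : 4 * Em ≠ ⊤ := ENNReal.mul_ne_top (by norm_num) hEm_top
  have hqm'le : qm' ≤ 2 * (En - Em) + Em * sm := ENNReal.le_of_add_le_add_right h4top hkey
  -- (7) drop the potential term
  calc ∫⁻ X in cellN N L, kineticDensity (fun Y => Ψn.ψ Y - Ψm.ψ Y) X ≤ qm' := by
        rw [← hqm']; exact lintegral_mono fun X => le_self_add
    _ ≤ 2 * (En - Em) + Em * sm := hqm'le

end Summit.AtomisticToContinuum.BoseEinsteinCondensation.Cruxes.HardCoreExtension.ThirdLawCurrentFloor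

end
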